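import Summits.BirchSwinnertonDyer.Rank1Residual.X11b.ShapiroPairs
import HarnessLib

/-!
# BSD rank-≤1, LITERAL row D5 `JET@p∣N` at `p = 3` (cell `bsd-jet`, road C3 «DESC3»): the COMPACT record shape —
# many literal models per file, ONE `decide`, and the door from list membership to `BSD(E,3)` by the class-free
# two-engine EXACT `3`-descent certificate line

HONEST FRAMING (programme `BSD-LIT2PART-PROGRAMME-v1.md` §HONESTY, verbatim): «no tranche here proves BSD; ARM L moves
the LITERAL column of an r ≤ 1 census into the kernel-proved-modulo-named-print column; ARM P changes what «named print»
is worth. The residue (4.31 %) and every SUMMIT-BEARING rung (S0–S3) stay theorem-bound and are staffed by the 22 routes,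
not by this programme.» This file is a TOOL: theorems only (no definition, no named fact, no `sorry`); PER PAIR; nothing
is booked here; nothing about any particular curve is asserted. Cell `bsd-jet` (run/shared/lean/pub/bsd-jet/), seat
`bsd-jet-ty` (typer), gen 0; plan of record `HOME/JET-PLAN.md` (bsd-jet-lead) §1 road C3, §4 row schema.

WHY. The by-name record shape of road C3 is x11c gen 12's literal-model instance
`X11b.bsdp_of_ainvs_of_card_selmerGroup` (`X11b/ShapiroPairs.lean`) of the class-free consumer
`Typed.bsdp_of_card_selmerGroup_eq_pow_analyticRank` — one theorem `bsdp3_jet_<label>` per class (generator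
`HOME/staging/bsd-jet-ty/tools/gen_jet_desc3_records.py`, pattern `Supersingular.bsdp3_r1u_<label>`), whose ONLY kernel
work is `Δ ≠ 0` of the literal model. At ≤ 400 lines per file that is ≤ 18 records per file: fine for the 1 000-class
pilot (≈ 56 files), NOT for the production universe U3 (165 246 classes ⇒ ≈ 9 200 files through the gate). Referee A's
F3BW / SEL3X precedents (R196.6, R198.17) booked from the TABLE + the class-free consumer BY NAME with per-class rows
OPTIONAL; should a kernel object per class nevertheless be wanted at production scale, this file gives the COMPACT
shape: a file states ONE theorem `checked_jet3_<NN> : ∀ a ∈ L, discOf a ≠ 0` for a literal list `L` of a few hundred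
models (`decide +kernel`; the list is written inline in the statement, so the file stays theorems-only), and the door
`bsdp3_of_forall_discOf_ne_zero` below turns membership `[a₁,…,a₆] ∈ L` (again `decide`) + the published binder `hGZK` +
the data binders `r_an ≤ 1`, `#Ш_an` a `3`-unit + the ONE certificate line `hSel : #Sel^(3)(E/ℚ) = 3 ^ r_an` into
`BSD(E,3)` for that model — the same term for every class, so a booking names (`checked_jet3_<NN>`, the row's model) instead
of a per-class declaration. Which shape (TABLE only / by-name rows / compact lists) a production OFFER carries is referee
A's call on the pilot WAKE (JET-PLAN §2 seat `ty` (ii)); this file only makes the third option exist.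

* `bsdp3_of_forall_discOf_ne_zero` — the door (any prime `p`, stated at `p` general; road C3 uses `p = 3`).
* `checked_jet3_selftest` / `example` — kernel self-test on the five pilot-sample models of
  `HOME/staging/bsd-jet-ty/sample/sample_table.tsv` (`1818j1`, `2256l1`, `2862e1`, `3486i1`, `5742k1`), showing the
  intended use; asserts nothing about those curves beyond `Δ ≠ 0`.

References: Schaefer–Stoll, Trans. AMS 356 (2004) §2–3 [SchaeferStoll2004]; Silverman, *AEC* (2009) III.1, X.4
[SilvermanAEC2009]; Miller, LMS JCM 14 (2011) §1, Def. 1.1 [Miller2011LMS]; Cremona's tables [Cremona2006].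
-/

set_option autoImplicit false

noncomputable section

open scoped Classical

open WeierstrassCurve Literature.NumberTheory.EllipticCurves
  Literature.NumberTheory.EllipticCurves.Rank1Residual
  Literature.NumberTheory.EllipticCurves.Rank1Residual.Typed
  Literature.NumberTheory.EllipticCurves.Rank1Residual.X11RankOneCertificates
  Summit.BirchSwinnertonDyer.Rank1Residual.X11b

namespace Summit.BirchSwinnertonDyer.Rank1Residual.JET

/-- **The door of the compact record shape.** For a literal list `L` of integer models all of which have `Δ ≠ 0`
(`hL`, ONE `decide` per file), a member `[a₁, a₂, a₃, a₄, a₆] ∈ L` (`decide`), a prime `p`, the published binder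
`hGZK` (Gross–Zagier–Kolyvagin), the data binders `r_an ≤ 1` and `#Ш_an = q` with `ord_p q = 0`, and the ONE
two-engine certificate line `hSel : #Sel^(p)(E/ℚ) = p ^ r_an`: Miller's `BSD(E,p)` for `W = [a₁,…,a₆]`, through x11c's
`X11b.bsdp_of_ainvs_of_card_selmerGroup` (= `Typed.bsdp_of_card_selmerGroup_eq_pow_analyticRank` on a literal model).
Per pair; no class statement; nothing booked. [cite: Miller2011LMS, §1 and Def. 1.1] [cite: SilvermanAEC2009, Thm X.4.2] -/
theorem bsdp3_of_forall_discOf_ne_zero (hGZK : rank_eq_analyticRank_of_analyticRank_le_one)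
    {L : List (List ℤ)} (hL : ∀ a ∈ L, discOf a ≠ 0) (a1 a2 a3 a4 a6 : ℤ)
    (hmem : [a1, a2, a3, a4, a6] ∈ L) (p : ℕ) [Fact p.Prime]
    (W : WeierstrassCurve ℚ) (hW : W = ⟨a1, a2, a3, a4, a6⟩)
    (hr : W.analyticRank ≤ 1) {q : ℚ} (hq : shaAn W = (q : ℂ)) (hv : padicValRat p q = 0)
    (hSel : Nat.card (W.selmerGroup (p : ℤ)) = p ^ W.analyticRank) : BSDp W p := by
  subst hW
  exact bsdp_of_ainvs_of_card_selmerGroup hGZK a1 a2 a3 a4 a6 (hL _ hmem) p hr hq hv hSel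

/-- Kernel self-test of the compact shape on the five pilot-sample models `1818j1`, `2256l1`, `2862e1`, `3486i1`,
`5742k1` (Cremona): every listed model has `Δ ≠ 0`. ONE `decide`. [folklore] -/
theorem checked_jet3_selftest :
    ∀ a ∈ ([[1, -1, 1, -2, -7], [0, 1, 0, -128, 756], [1, -1, 0, -43728, 3165056], [1, 1, 1, 99, -1567245],
      [1, -1, 0, -2529, -48353]] : List (List ℤ)), discOf a ≠ 0 := by
  decide +kernel

/-- How a row is consumed (here `2256l1 = [0, 1, 0, -128, 756]` at `p = 3`): membership by `decide`, the rest displayed.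
Asserts nothing about `2256l1` beyond the shape. [folklore] -/
example (hGZK : rank_eq_analyticRank_of_analyticRank_le_one) (W : WeierstrassCurve ℚ)
    (hW : W = ⟨0, 1, 0, -128, 756⟩) (hr : W.analyticRank ≤ 1) {q : ℚ} (hq : shaAn W = (q : ℂ))
    (hv : padicValRat 3 q = 0) (hSel : Nat.card (W.selmerGroup (3 : ℤ)) = 3 ^ W.analyticRank) : BSDp W 3 :=
  haveI : Fact (Nat.Prime 3) := ⟨by norm_num⟩
  bsdp3_of_forall_discOf_ne_zero hGZK checked_jet3_selftest 0 1 0 (-128) 756 (by decide) 3 W hW hr hq hv hSel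

end Summit.BirchSwinnertonDyer.Rank1Residual.JET

end
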